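import Summits.CriticalPhenomena.PercolationContinuityZ3.Theorems.PercNearOneGluingNoHeavyLowerTailKnQuestion8CoefficientwiseOffClusterGen
import HarnessLib

/-!
# The top stratum of the root-set stratification is nonnegative — prim-lf-2 gen 56

Support file (`--supports stmt-CriticalPhenomena-4575`, closed), prover `prim-lf-2` (gen 56).  No definitions, no named facts, no sorries; standard axioms.
Memo `prim-lf-2/CW-DELCON-gen56.md` §7; companion `…CoefficientwiseStrata.lean` (`noCore_of_strata`, whose hypothesis `hTop` this file discharges).

* `Coefficientwise.noCore_topStratum_nonneg` — for a finite vertex type, `y ≠ x` and monotone `f, g`: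
  `0 ≤ Σ_{s ⊆ E : y not doubly joined to V∖{y}} (f(C_x s) − f(C_x(E∖s)))·(g(C_x s) − g(C_x(E∖s)))`.
  'Doubly joined to `V∖{y}`' means: `y` has a red non-loop edge and a blue non-loop edge; so the event is 'the star of `y` is monochromatic', the two halves are exchanged by the colour
  swap, and the half 'no red edge at `y`' is the two-function Harris sum on `(E ∖ star y).powerset` with the dominating complement-side function `t ↦ f(C_x(t ∪ star y))` —
  `offCluster_twoColouring_nonneg_gen_sub` with `A = ∅`.
[cite: KozmaNitzan2024, Questions 8–9 (§5.5 p. 36) (context: the Question-8 pocket covariance programme)]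
-/

namespace Summit.CriticalPhenomena.PercolationContinuityZ3.Theorems

open Finset Literature.Probability.Percolation

namespace Coefficientwise

variable {ι V : Type*} [DecidableEq ι]

omit [DecidableEq ι] in
/-- If `y ≠ a` lies in the red cluster of `a`, some red NON-LOOP edge ends at `y`. [cite: KozmaNitzan2024, §5.5 (context only; folklore)] -/
theorem exists_properEdge_of_mem_openCluster (ends : ι → Sym2 V) {s : Finset ι} {a y : V}
    (hy : y ∈ openCluster (ends '' (↑s : Set ι)) a) (hya : y ≠ a) : ∃ i ∈ s, ∃ w : V, w ≠ y ∧ ends i = s(w, y) := by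
  change (openGraph (ends '' (↑s : Set ι))).Reachable a y at hy
  rw [SimpleGraph.reachable_iff_reflTransGen] at hy
  rcases Relation.ReflTransGen.cases_tail hy with h | ⟨c, _, hcy⟩
  · exact absurd h hya
  · rw [openGraph_image_adj] at hcy
    obtain ⟨⟨i, hi, hicy⟩, hne⟩ := hcy
    exact ⟨i, hi, c, hne, hicy⟩

open Classical in
/-- **The top stratum is nonnegative.**  For finite `V`, `y ≠ x` and monotone `f, g`: the two-colouring sum of `(f(C_x s) − f(C_x(E∖s)))(g(C_x s) − g(C_x(E∖s)))` over the colourings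
`s ⊆ E` in which `y` is NOT doubly joined to `V ∖ {y}` (i.e. the non-loop edges at `y` are monochromatic) is `≥ 0`.  [cite: KozmaNitzan2024, Questions 8–9 (§5.5 p. 36) (context)] -/
theorem noCore_topStratum_nonneg [Fintype V] (ends : ι → Sym2 V) (E : Finset ι) (x y : V) (f g : Set V → ℝ) (hf : Monotone f) (hg : Monotone g) :
    0 ≤ ∑ s ∈ E.powerset.filter (fun s : Finset ι =>
          ¬ ((∃ a ∈ (Finset.univ : Finset V).erase y, y ∈ openCluster (ends '' (↑s : Set ι)) a) ∧
             (∃ a ∈ (Finset.univ : Finset V).erase y, y ∈ openCluster (ends '' (↑(E \ s) : Set ι)) a))),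
        (f (openCluster (ends '' (↑s : Set ι)) x) - f (openCluster (ends '' (↑(E \ s) : Set ι)) x)) *
          (g (openCluster (ends '' (↑s : Set ι)) x) - g (openCluster (ends '' (↑(E \ s) : Set ι)) x)) := by
  set K : Finset ι → Set V := fun s => openCluster (ends '' (↑s : Set ι)) x with hK
  set T : Finset ι → ℝ := fun s => (f (K s) - f (K (E \ s))) * (g (K s) - g (K (E \ s))) with hT
  have hKmono : ∀ {s t : Finset ι}, s ⊆ t → K s ⊆ K t := fun hst => openCluster_image_mono ends hst x
  -- the star of `y` (non-loop edges of `E` at `y`) and the joined-ness predicate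
  set St : Finset ι := E.filter (fun i => ∃ w : V, w ≠ y ∧ ends i = s(w, y)) with hSt
  have hStE : St ⊆ E := Finset.filter_subset _ E
  have joined_iff : ∀ t : Finset ι, t ⊆ E →
      ((∃ a ∈ (Finset.univ : Finset V).erase y, y ∈ openCluster (ends '' (↑t : Set ι)) a) ↔ (t ∩ St).Nonempty) := by
    intro t ht
    constructor
    · rintro ⟨a, ha, hay⟩
      have hay' : y ≠ a := fun h => (Finset.mem_erase.mp ha).1 h.symm
      obtain ⟨i, hi, w, hwy, hiw⟩ := exists_properEdge_of_mem_openCluster ends hay hay'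
      exact ⟨i, Finset.mem_inter.mpr ⟨hi, Finset.mem_filter.mpr ⟨ht hi, w, hwy, hiw⟩⟩⟩
    · rintro ⟨i, hi⟩
      obtain ⟨hit, hiSt⟩ := Finset.mem_inter.mp hi
      obtain ⟨_, w, hwy, hiw⟩ := Finset.mem_filter.mp hiSt
      refine ⟨w, Finset.mem_erase.mpr ⟨hwy, Finset.mem_univ w⟩, ?_⟩
      have hadj : (openGraph (ends '' (↑t : Set ι))).Adj w y := by
        rw [openGraph_image_adj]; exact ⟨⟨i, hit, hiw⟩, hwy⟩
      exact hadj.reachable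
  change 0 ≤ ∑ s ∈ E.powerset.filter (fun s : Finset ι => ¬ ((∃ a ∈ (Finset.univ : Finset V).erase y, y ∈ openCluster (ends '' (↑s : Set ι)) a) ∧
      (∃ a ∈ (Finset.univ : Finset V).erase y, y ∈ openCluster (ends '' (↑(E \ s) : Set ι)) a))), T s
  -- the half-sum over colourings with no red edge at `y` is nonnegative (two-function Harris with domination on `E ∖ St`)
  set E' : Finset ι := E \ St with hE'
  have half : 0 ≤ ∑ s ∈ E.powerset.filter (fun s => s ∩ St = ∅), T s := by
    have key := offCluster_twoColouring_nonneg_gen_sub ends E' x (∅ : Set V) f g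
      (fun t => f (K (t ∪ St))) (fun t => g (K (t ∪ St))) hf hg
      (fun a b hab => hf (hKmono (Finset.union_subset_union hab le_rfl)))
      (fun a b hab => hg (hKmono (Finset.union_subset_union hab le_rfl)))
      (fun t _ => hf (hKmono Finset.subset_union_left)) (fun t _ => hg (hKmono Finset.subset_union_left))
    have key2 : 0 ≤ ∑ t ∈ E'.powerset, (f (K t) - f (K ((E' \ t) ∪ St))) * (g (K t) - g (K ((E' \ t) ∪ St))) := by
      convert key using 2
      exact (@Finset.filter_true_of_mem _ _ (_) _ (fun t _ a ha => absurd ha (Set.notMem_empty a))).symm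
    -- identify the two sums: `{s ⊆ E : s ∩ St = ∅} = E'.powerset` and `(E' ∖ t) ∪ St = E ∖ t`
    have hset : E.powerset.filter (fun s => s ∩ St = ∅) = E'.powerset := by
      ext t
      simp only [Finset.mem_filter, Finset.mem_powerset, hE', Finset.subset_sdiff]
      constructor
      · rintro ⟨htE, ht⟩; exact ⟨htE, Finset.disjoint_iff_inter_eq_empty.mpr ht⟩
      · rintro ⟨htE, ht⟩; exact ⟨htE, Finset.disjoint_iff_inter_eq_empty.mp ht⟩
    rw [hset]
    refine le_trans key2 (le_of_eq (Finset.sum_congr rfl fun t ht => ?_))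
    have htE' := Finset.mem_powerset.mp ht
    have hcomp : (E' \ t) ∪ St = E \ t := by
      ext i
      simp only [Finset.mem_union, Finset.mem_sdiff, hE']
      constructor
      · rintro (⟨⟨hiE, hiSt⟩, hit⟩ | hiSt)
        · exact ⟨hiE, hit⟩
        · refine ⟨hStE hiSt, fun hit => ?_⟩
          have := htE' hit
          rw [hE', Finset.mem_sdiff] at this
          exact this.2 hiSt
      · rintro ⟨hiE, hit⟩
        by_cases hiSt : i ∈ St
        · exact Or.inr hiSt
        · exact Or.inl ⟨⟨hiE, hiSt⟩, hit⟩
    simp only [hT, hcomp]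
  -- case split: no proper edge at `y` at all, or the event is the disjoint union of the two monochromatic halves
  by_cases hSt0 : St = ∅
  · -- every colouring qualifies on the red side trivially: the event is `s ∩ St = ∅` for all `s`, i.e. everything
    have hev : E.powerset.filter (fun s : Finset ι => ¬ ((∃ a ∈ (Finset.univ : Finset V).erase y, y ∈ openCluster (ends '' (↑s : Set ι)) a) ∧
        (∃ a ∈ (Finset.univ : Finset V).erase y, y ∈ openCluster (ends '' (↑(E \ s) : Set ι)) a))) = E.powerset.filter (fun s => s ∩ St = ∅) := by
      refine Finset.filter_congr fun s hs => ?_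
      rw [joined_iff s (Finset.mem_powerset.mp hs)]
      simp [hSt0]
    rw [hev]; exact half
  · have hev : ∀ s ∈ E.powerset, (¬ ((∃ a ∈ (Finset.univ : Finset V).erase y, y ∈ openCluster (ends '' (↑s : Set ι)) a) ∧
        (∃ a ∈ (Finset.univ : Finset V).erase y, y ∈ openCluster (ends '' (↑(E \ s) : Set ι)) a))) ↔ (s ∩ St = ∅ ∨ (E \ s) ∩ St = ∅) := by
      intro s hs
      rw [joined_iff s (Finset.mem_powerset.mp hs), joined_iff (E \ s) Finset.sdiff_subset, not_and_or,
        Finset.not_nonempty_iff_eq_empty, Finset.not_nonempty_iff_eq_empty]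
    have hdisj : ∀ s ∈ E.powerset, ¬ (s ∩ St = ∅ ∧ (E \ s) ∩ St = ∅) := by
      intro s _ ⟨h1, h2⟩
      apply hSt0
      ext i
      simp only [Finset.notMem_empty, iff_false]
      intro hiSt
      by_cases his : i ∈ s
      · have : i ∈ s ∩ St := Finset.mem_inter.mpr ⟨his, hiSt⟩
        rw [h1] at this; exact Finset.notMem_empty i this
      · have : i ∈ (E \ s) ∩ St := Finset.mem_inter.mpr ⟨Finset.mem_sdiff.mpr ⟨hStE hiSt, his⟩, hiSt⟩
        rw [h2] at this; exact Finset.notMem_empty i this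
    have hsplit : ∑ s ∈ E.powerset.filter (fun s : Finset ι => ¬ ((∃ a ∈ (Finset.univ : Finset V).erase y, y ∈ openCluster (ends '' (↑s : Set ι)) a) ∧
        (∃ a ∈ (Finset.univ : Finset V).erase y, y ∈ openCluster (ends '' (↑(E \ s) : Set ι)) a))), T s =
        ∑ s ∈ E.powerset.filter (fun s => s ∩ St = ∅), T s + ∑ s ∈ E.powerset.filter (fun s => (E \ s) ∩ St = ∅), T s := by
      rw [Finset.sum_filter, Finset.sum_filter, Finset.sum_filter, ← Finset.sum_add_distrib]
      refine Finset.sum_congr rfl fun s hs => ?_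
      rw [if_congr (hev s hs) rfl rfl]
      by_cases h1 : s ∩ St = ∅ <;> by_cases h2 : (E \ s) ∩ St = ∅
      · exact absurd ⟨h1, h2⟩ (hdisj s hs)
      · simp [h1, h2]
      · simp [h1, h2]
      · simp [h1, h2]
    rw [hsplit]
    refine add_nonneg half ?_
    -- the blue half equals the red half by the colour swap
    have e1 : ∑ s ∈ E.powerset.filter (fun s => (E \ s) ∩ St = ∅), T s = ∑ s ∈ E.powerset.filter (fun s => s ∩ St = ∅), T s := by
      rw [Finset.sum_filter, Finset.sum_filter, ← sum_powerset_sdiff E (fun t => if t ∩ St = ∅ then T t else 0)]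
      refine Finset.sum_congr rfl fun s hs => ?_
      have hss : E \ (E \ s) = s := Finset.sdiff_sdiff_eq_self (Finset.mem_powerset.mp hs)
      refine if_congr Iff.rfl ?_ rfl
      simp only [hT, hss]; ring
    rw [e1]; exact half

end Coefficientwise

end Summit.CriticalPhenomena.PercolationContinuityZ3.Theorems
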